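import Literature.Topology.FourManifolds.WallHandlebodySlab
import Literature.Topology.FourManifolds.WallHandlebodyBlend
import Literature.Topology.FourManifolds.RegularSlabTransfer
import HarnessLib

/-!
# Wall 1964, Lemma 2, Morse-theoretic route: one Morse function on `W` cutting out the
# handlebody `H = D⁵ ∪ {g ≤ m}`

Topic `Literature/Topology/FourManifolds` (fact seat
`provefact-Literature.Topology.FourManifolds.exists-68ee520c9a`, Wall 1964, Lemma 2,
`WallBoundingHandlebody.lean`; the analytic half of item 6 of the route recorded there).
Everything here is **proved**; no named facts.

Data: the bottom slab `K = f⁻¹[a₀, b₀]` of the null-cobordism `W` of `M` (`BottomSlab`,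
`WallHandlebodySlab.lean`: `f` a Morse function of `(W; ∅, M)`, `{f ≤ a₀}` a chart ball about
the minimum `p₀`), a Morse function `g` of the triad `(K; f⁻¹(a₀), f⁻¹(b₀))` (in the application
the output of Milnor's §§4–8, `WallHandlebodyProgram.lean`) and a level `m ∈ (0, 1)`.  With
the blend `φ` of `u = (f − a₀)/(b₀ − a₀)|_K` and `g` near `f⁻¹(a₀)` (`WallHandlebodyBlend.lean`:
`φ = u` on `{g ≤ δ/3}`, `φ = (3/δ) g` on `{g ≥ 2δ/3}`, `δ < m`) and a top cut-off `θ`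
(`θ(t) = t` for `t ≤ A m₁`, `θ ≡ A = 3/δ` for `t ≥ A m₂`, `m < m₁ < m₂ < 1`), the function

  `Ψ = f` on `{f < a₀}`,  `Ψ = a₀ + (b₀ − a₀) · θ(φ)` on `K`,  `Ψ ≡ a₀ + (b₀ − a₀) A` above `b₀`

(`Splice.Ψ`) is ONE smooth function on `W` (`Splice.contMDiff_Ψ`: it is `f` on an open set
around `{f ≤ a₀}`, constant on an open set around `{b₀ ≤ f}`, and on the open slab it is read
through the slab, `RegularSlabTransfer.lean`), whose sublevel set at `μ = a₀ + (b₀ − a₀) A m`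
is `{f < a₀} ∪ {g ≤ m}` (`Splice.Ψ_le_μ_iff_of_mem`, `Splice.Ψ_incl_eq_μ_iff`), lying in the
interior of `W` (`Splice.isInteriorPoint_of_Ψ_le`), with `μ` a regular value
(`Splice.Ψ_ne_μ_of_isMCriticalPt`).  Wall (1964, p. 144): "`H` … can be chosen to be a smooth
submanifold of `W`".  The Morse data of `Ψ` on `{Ψ ≤ μ}` and the handlebody are in
`WallHandlebodyHandles.lean`.

## References

* C. T. C. Wall, *On simply-connected 4-manifolds*, J. London Math. Soc. 39 (1964), proof of
  Lemma 2 (p. 144). [WallJLMS1964]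
* J. Milnor, *Lectures on the h-cobordism theorem* (1965), Def. 3.1, Lemma 2.9, Thm. 4.8
  (alternate version). [MilnorHCobordism1965]
-/

open scoped Manifold ContDiff Topology
open Set Function Filter

noncomputable section

universe u

namespace Literature.Topology.FourManifolds

/-- Local notation: `𝔼 n` is the model Euclidean space `EuclideanSpace ℝ (Fin n)`. -/
local notation "𝔼 " n:arg => EuclideanSpace ℝ (Fin n)

namespace NullCobordism

variable {n : ℕ} {M : Type u} [TopologicalSpace M] [ChartedSpace (𝔼 n) M]

namespace BottomSlab

variable {c : NullCobordism n M} (S : c.BottomSlab)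

/-- **The splice data**: for a Morse function `g` of the triad on `K` and a level `m`, the
blend `φ` of `u = fn` and `g` near the incoming end with its collar width `δ < m` and all the
properties delivered by `Cobordism.IsMorseFunction.exists_blend` (`WallHandlebodyBlend.lean`).
[cite: MilnorHCobordism1965, Def. 3.1 and Thm. 4.8 (alternate version)] [cite: WallJLMS1964, proof of Lemma 2 (p. 144)] -/
structure Splice (g : S.K → ℝ) (m : ℝ) where
  /-- The collar width of the blend. -/
  δ : ℝ
  /-- The blend of `fn` and `g`. -/
  φ : S.K → ℝ
  δ_pos : 0 < δ
  δ_lt_one : δ < 1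
  δ_lt : δ < m
  contMDiff_φ : ContMDiff (𝓡∂ (n + 1)) 𝓘(ℝ, ℝ) ∞ φ
  φ_eq_fn : ∀ p, g p ≤ δ / 3 → φ p = RegularSlab.fn S.isRegularSlab p
  φ_eq_mul : ∀ p, 2 * δ / 3 ≤ g p → φ p = 3 / δ * g p
  not_isMCriticalPt : ∀ p, g p ≤ δ → ¬ IsMCriticalPt (𝓡∂ (n + 1)) φ p
  δ_lt_of_mem : ∀ p ∈ criticalSet (𝓡∂ (n + 1)) g, δ < g p
  δ_lt_of_mem_fn : ∀ p ∈ criticalSet (𝓡∂ (n + 1)) (RegularSlab.fn S.isRegularSlab), δ < g p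
  criticalSet_φ : criticalSet (𝓡∂ (n + 1)) φ = criticalSet (𝓡∂ (n + 1)) g
  φ_eventuallyEq : ∀ p ∈ criticalSet (𝓡∂ (n + 1)) g, φ =ᶠ[𝓝 p] fun q => 3 / δ * g q + 0
  morseIndex_φ : ∀ p ∈ criticalSet (𝓡∂ (n + 1)) g,
    morseIndex (𝓡∂ (n + 1)) φ p = morseIndex (𝓡∂ (n + 1)) g p
  isMorse_φ : IsMorse (𝓡∂ (n + 1)) φ
  φ_nonneg : ∀ p, 0 ≤ φ p
  φ_eq_zero_iff : ∀ p, φ p = 0 ↔ RegularSlab.fn S.isRegularSlab p = 0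
  φ_le_max : ∀ p, φ p ≤ max (RegularSlab.fn S.isRegularSlab p) (3 / δ * g p)
  m_pos : 0 < m
  m_lt_one : m < 1

/-- **Existence of the splice data** (`Cobordism.IsMorseFunction.exists_blend`).
[cite: MilnorHCobordism1965, Def. 3.1 and Thm. 4.8 (alternate version)] -/
theorem nonempty_splice [T2Space M] [SecondCountableTopology M] [IsManifold (𝓡 n) ∞ M]
    [CompactSpace M] (hn : 1 ≤ n) {g : S.K → ℝ} (hg : S.cobordism.IsMorseFunction g) {m : ℝ}
    (hm : m ∈ Ioo (0 : ℝ) 1) : Nonempty (S.Splice g m) := by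
  obtain ⟨δ, φ, h0, h1, hm', hs, hlow, hhigh, hnocrit, hcritg, hcritu, hcriteq, hev, hind, hmorse,
    hnonneg, hzero, hle⟩ := (S.isMorseFunction_fn hn).exists_blend hg hm.1
  exact ⟨⟨δ, φ, h0, h1, hm', hs, hlow, hhigh, hnocrit, hcritg, hcritu, hcriteq, hev, hind, hmorse,
    hnonneg, hzero, hle, hm.1, hm.2⟩⟩

namespace Splice

variable {S} {g : S.K → ℝ} {m : ℝ} (D : S.Splice g m)

/-- The slope `A = 3/δ` of the blend above the collar. [folklore] -/
def A : ℝ := 3 / D.δ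

/-- `A = 3/δ` (definitional). [folklore] -/
theorem A_def : D.A = 3 / D.δ := rfl

/-- `A > 0`. [folklore] -/
theorem A_pos : 0 < D.A := by rw [A_def]; exact div_pos (by norm_num) D.δ_pos

/-- `A > 3` (as `δ < 1`). [folklore] -/
theorem three_lt_A : 3 < D.A := by
  rw [A_def, lt_div_iff₀ D.δ_pos]; nlinarith [D.δ_lt_one, D.δ_pos]

/-- `A δ = 3`. [folklore] -/
theorem A_mul_δ : D.A * D.δ = 3 := by
  rw [A_def, div_mul_cancel₀ _ D.δ_pos.ne']

/-- The two cut-off levels `m < m₁ < m₂ < 1`. [folklore] -/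
def m₁ (_D : S.Splice g m) : ℝ := (2 * m + 1) / 3

/-- The upper cut-off level. [folklore] -/
def m₂ (_D : S.Splice g m) : ℝ := (m + 2) / 3

/-- `m₁ = (2m + 1)/3` (definitional). [folklore] -/
theorem m₁_def : D.m₁ = (2 * m + 1) / 3 := rfl
/-- `m₂ = (m + 2)/3` (definitional). [folklore] -/
theorem m₂_def : D.m₂ = (m + 2) / 3 := rfl

/-- The top cut-off `θ`: `θ(t) = t + χ₂(t) (A − t)` with the smooth step `χ₂` from `A m₁` to
`A m₂`. [folklore] -/
def θ (t : ℝ) : ℝ := t + Real.smoothTransition ((t - D.A * D.m₁) / (D.A * D.m₂ - D.A * D.m₁)) * (D.A - t)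

/-- Unfolding `θ`. [folklore] -/
theorem θ_def (t : ℝ) :
    D.θ t = t + Real.smoothTransition ((t - D.A * D.m₁) / (D.A * D.m₂ - D.A * D.m₁)) * (D.A - t) :=
  rfl

/-- The restriction to `K` of the spliced function: `ψ = a₀ + (b₀ − a₀) θ(φ)`. [folklore] -/
def ψ (p : S.K) : ℝ := S.botLevel + (S.b₀ - S.botLevel) * D.θ (D.φ p)

/-- Unfolding `ψ`. [folklore] -/
theorem ψ_def (p : S.K) : D.ψ p = S.botLevel + (S.b₀ - S.botLevel) * D.θ (D.φ p) := rfl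

open Classical in
/-- **The spliced function on `W`**: `f` below the ball level `a₀`, `a₀ + (b₀ − a₀) θ(φ)` on the
slab `K = f⁻¹[a₀, b₀]`, the constant `a₀ + (b₀ − a₀) A` above `b₀`.
[cite: WallJLMS1964, proof of Lemma 2 (p. 144)] -/
def Ψ (z : c.W) : ℝ :=
  if hz : S.f z ∈ Icc S.botLevel S.b₀ then D.ψ (RegularSlab.mk S.isRegularSlab z hz)
  else if S.f z < S.botLevel then S.f z else S.botLevel + (S.b₀ - S.botLevel) * D.A

/-- The level of `Ψ` cutting out the handlebody: `μ = a₀ + (b₀ − a₀) A m`. [folklore] -/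
def μ : ℝ := S.botLevel + (S.b₀ - S.botLevel) * (D.A * m)

/-- Unfolding `μ`. [folklore] -/
theorem μ_def : D.μ = S.botLevel + (S.b₀ - S.botLevel) * (D.A * m) := rfl

/-! #### Elementary inequalities -/

/-- `m < m₁`. [folklore] -/
theorem m_lt_m₁ : m < D.m₁ := by rw [m₁_def]; linarith [D.m_lt_one]
/-- `m₁ < m₂`. [folklore] -/
theorem m₁_lt_m₂ : D.m₁ < D.m₂ := by rw [m₁_def, m₂_def]; linarith [D.m_lt_one]
/-- `m₂ < 1`. [folklore] -/
theorem m₂_lt_one : D.m₂ < 1 := by rw [m₂_def]; linarith [D.m_lt_one]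
/-- `0 < m₁`. [folklore] -/
theorem m₁_pos : 0 < D.m₁ := by rw [m₁_def]; linarith [D.m_pos]
/-- `δ < m₂`. [folklore] -/
theorem δ_lt_m₂ : D.δ < D.m₂ := D.δ_lt.trans (D.m_lt_m₁.trans D.m₁_lt_m₂)
/-- `A m₁ < A m₂`. [folklore] -/
theorem Am₁_lt_Am₂ : D.A * D.m₁ < D.A * D.m₂ := mul_lt_mul_of_pos_left D.m₁_lt_m₂ D.A_pos
/-- `A m < A m₁`. [folklore] -/
theorem Am_lt_Am₁ : D.A * m < D.A * D.m₁ := mul_lt_mul_of_pos_left D.m_lt_m₁ D.A_pos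
/-- `A m₂ < A`. [folklore] -/
theorem Am₂_lt_A : D.A * D.m₂ < D.A := by nlinarith [D.m₂_lt_one, D.A_pos]
/-- `3 < A m` (as `δ < m`). [folklore] -/
theorem three_lt_Am : 3 < D.A * m := by
  have := D.A_mul_δ; nlinarith [D.δ_lt, D.A_pos]
/-- `1 < A m₁`. [folklore] -/
theorem one_lt_Am₁ : 1 < D.A * D.m₁ := by linarith [D.three_lt_Am, D.Am_lt_Am₁]

/-- `0 < b₀ − a₀`. [folklore] -/
theorem sub_pos (_D : S.Splice g m) : 0 < S.b₀ - S.botLevel := _root_.sub_pos.2 S.botLevel_lt_b₀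

/-! #### The top cut-off -/

/-- `θ(t) = t` for `t ≤ A m₁`. [folklore] -/
theorem θ_of_le {t : ℝ} (ht : t ≤ D.A * D.m₁) : D.θ t = t := by
  rw [θ_def, Real.smoothTransition.zero_of_nonpos, zero_mul, add_zero]
  exact div_nonpos_of_nonpos_of_nonneg (by linarith) (by linarith [D.Am₁_lt_Am₂])

/-- `θ(t) = A` for `A m₂ ≤ t`. [folklore] -/
theorem θ_of_ge {t : ℝ} (ht : D.A * D.m₂ ≤ t) : D.θ t = D.A := by
  rw [θ_def, Real.smoothTransition.one_of_one_le, one_mul]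
  · ring
  · rw [le_div_iff₀ (by linarith [D.Am₁_lt_Am₂])]; linarith

/-- `t ≤ θ(t) ≤ A` for `t ≤ A`. [folklore] -/
theorem le_θ {t : ℝ} (ht : t ≤ D.A) : t ≤ D.θ t ∧ D.θ t ≤ D.A := by
  rw [θ_def]
  have h0 := Real.smoothTransition.nonneg ((t - D.A * D.m₁) / (D.A * D.m₂ - D.A * D.m₁))
  have h1 := Real.smoothTransition.le_one ((t - D.A * D.m₁) / (D.A * D.m₂ - D.A * D.m₁))
  constructor <;> nlinarith

/-- `θ` is smooth. [folklore] -/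
theorem contDiff_θ : ContDiff ℝ ∞ D.θ := by
  have h : D.θ = fun t => t + Real.smoothTransition ((t - D.A * D.m₁) / (D.A * D.m₂ - D.A * D.m₁)) *
      (D.A - t) := rfl
  rw [h]
  exact contDiff_id.add ((Real.smoothTransition.contDiff.comp
    ((contDiff_id.sub contDiff_const).div_const _)).mul (contDiff_const.sub contDiff_id))

/-! #### Bounds for the blend `φ` -/

/-- `fn ≤ 1` on `K`. [folklore] -/
theorem fn_le_one [T2Space M] [SecondCountableTopology M] [IsManifold (𝓡 n) ∞ M] [CompactSpace M]
    (_D : S.Splice g m) (hn : 1 ≤ n) (p : S.K) : RegularSlab.fn S.isRegularSlab p ≤ 1 :=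
  ((S.isMorseFunction_fn hn).mem_Icc p).2

/-- `φ ≤ A` (as `φ ≤ max(fn, A g)`, `fn ≤ 1 < A`, `g ≤ 1`). [folklore] -/
theorem φ_le_A [T2Space M] [SecondCountableTopology M] [IsManifold (𝓡 n) ∞ M] [CompactSpace M]
    (hn : 1 ≤ n) (hg : S.cobordism.IsMorseFunction g) (p : S.K) : D.φ p ≤ D.A := by
  refine (D.φ_le_max p).trans (max_le ?_ ?_)
  · linarith [D.fn_le_one hn p, D.three_lt_A]
  · rw [← A_def]
    have := (hg.mem_Icc p).2
    nlinarith [D.A_pos]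

/-- Below `2δ/3` the blend is `≤ 2`. [folklore] -/
theorem φ_le_two [T2Space M] [SecondCountableTopology M] [IsManifold (𝓡 n) ∞ M] [CompactSpace M]
    (hn : 1 ≤ n) (hg : S.cobordism.IsMorseFunction g) {p : S.K} (hp : g p < 2 * D.δ / 3) :
    D.φ p ≤ 2 := by
  refine (D.φ_le_max p).trans (max_le ?_ ?_)
  · linarith [D.fn_le_one hn p]
  · rw [← A_def]
    have h0 := (hg.mem_Icc p).1
    have := D.A_mul_δ
    nlinarith [D.A_pos]

/-- **`φ ≤ A m ↔ g ≤ m`** (above `2δ/3` the blend is `A g`; below it both sides hold: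
`g < 2δ/3 < m` and `φ ≤ 2 < 3 < A m`). [folklore] -/
theorem φ_le_iff [T2Space M] [SecondCountableTopology M] [IsManifold (𝓡 n) ∞ M] [CompactSpace M]
    (hn : 1 ≤ n) (hg : S.cobordism.IsMorseFunction g) (p : S.K) : D.φ p ≤ D.A * m ↔ g p ≤ m := by
  by_cases hp : 2 * D.δ / 3 ≤ g p
  · rw [D.φ_eq_mul p hp, ← A_def]
    exact ⟨fun h => le_of_mul_le_mul_left h D.A_pos, fun h => mul_le_mul_of_nonneg_left h D.A_pos.le⟩
  · have hlt := not_le.1 hp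
    have h1 : g p ≤ m := by linarith [D.δ_lt, D.δ_pos]
    have h2 : D.φ p ≤ D.A * m := by linarith [D.φ_le_two hn hg hlt, D.three_lt_Am]
    exact ⟨fun _ => h1, fun _ => h2⟩

/-- **`φ < A m` when `g < m`.** [folklore] -/
theorem φ_lt_of_lt [T2Space M] [SecondCountableTopology M] [IsManifold (𝓡 n) ∞ M] [CompactSpace M]
    (hn : 1 ≤ n) (hg : S.cobordism.IsMorseFunction g) {p : S.K} (hp : g p < m) : D.φ p < D.A * m := by
  by_cases hp' : 2 * D.δ / 3 ≤ g p
  · rw [D.φ_eq_mul p hp', ← A_def]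
    exact mul_lt_mul_of_pos_left hp D.A_pos
  · linarith [D.φ_le_two hn hg (not_le.1 hp'), D.three_lt_Am]

/-- **`φ = A m ↔ g = m`.** [folklore] -/
theorem φ_eq_iff [T2Space M] [SecondCountableTopology M] [IsManifold (𝓡 n) ∞ M] [CompactSpace M]
    (hn : 1 ≤ n) (hg : S.cobordism.IsMorseFunction g) (p : S.K) : D.φ p = D.A * m ↔ g p = m := by
  constructor
  · intro h
    rcases lt_trichotomy (g p) m with hlt | heq | hgt
    · exact absurd h (D.φ_lt_of_lt hn hg hlt).ne
    · exact heq
    · have : ¬ D.φ p ≤ D.A * m := fun h' => absurd ((D.φ_le_iff hn hg p).1 h') (not_le.2 hgt)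
      exact absurd h.le this
  · intro h
    have hp : 2 * D.δ / 3 ≤ g p := by rw [h]; linarith [D.δ_lt, D.δ_pos]
    rw [D.φ_eq_mul p hp, ← A_def, h]

/-! #### The restriction `ψ` -/

/-- `ψ` is smooth on `K`. [folklore] -/
theorem contMDiff_ψ : ContMDiff (𝓡∂ (n + 1)) 𝓘(ℝ, ℝ) ∞ D.ψ :=
  ((contDiff_const.add (contDiff_const.mul D.contDiff_θ))).comp_contMDiff D.contMDiff_φ

/-- Where `φ ≤ A m₁`, `ψ = a₀ + (b₀ − a₀) φ`. [folklore] -/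
theorem ψ_eq_of_φ_le {p : S.K} (hp : D.φ p ≤ D.A * D.m₁) :
    D.ψ p = (S.b₀ - S.botLevel) * D.φ p + S.botLevel := by
  rw [ψ_def, D.θ_of_le hp]; ring

/-- Near a point with `φ < A m₁`, `ψ = (b₀ − a₀) φ + a₀`. [folklore] -/
theorem ψ_eventuallyEq {p : S.K} (hp : D.φ p < D.A * D.m₁) :
    D.ψ =ᶠ[𝓝 p] fun q => (S.b₀ - S.botLevel) * D.φ q + S.botLevel := by
  have ho : IsOpen {q : S.K | D.φ q < D.A * D.m₁} := isOpen_lt D.contMDiff_φ.continuous continuous_const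
  filter_upwards [ho.mem_nhds hp] with q hq
  exact D.ψ_eq_of_φ_le hq.le

/-- On `{g ≤ δ/3}`, `ψ = f` (the blend is `fn` there, and `f = a₀ + (b₀ − a₀) fn` on `K`).
[folklore] -/
theorem ψ_eq_f_of_le [T2Space M] [SecondCountableTopology M] [IsManifold (𝓡 n) ∞ M] [CompactSpace M]
    (hn : 1 ≤ n) {p : S.K} (hp : g p ≤ D.δ / 3) :
    D.ψ p = S.f (RegularSlab.incl S.isRegularSlab p) := by
  have h1 : D.φ p = RegularSlab.fn S.isRegularSlab p := D.φ_eq_fn p hp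
  have h2 : D.φ p ≤ D.A * D.m₁ := by rw [h1]; linarith [D.fn_le_one hn p, D.one_lt_Am₁]
  rw [D.ψ_eq_of_φ_le h2, h1, RegularSlab.apply_incl_eq S.isRegularSlab p]
  ring

/-- On `{m₂ ≤ g}`, `ψ` is the constant `a₀ + (b₀ − a₀) A`. [folklore] -/
theorem ψ_eq_const_of_ge {p : S.K} (hp : D.m₂ ≤ g p) :
    D.ψ p = S.botLevel + (S.b₀ - S.botLevel) * D.A := by
  have hp' : 2 * D.δ / 3 ≤ g p := by linarith [D.δ_lt_m₂, D.δ_pos]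
  have h1 : D.A * D.m₂ ≤ D.φ p := by
    rw [D.φ_eq_mul p hp', ← A_def]; exact mul_le_mul_of_nonneg_left hp D.A_pos.le
  rw [ψ_def, D.θ_of_ge h1]

/-- **`ψ ≤ μ ↔ g ≤ m`.** [folklore] -/
theorem ψ_le_μ_iff [T2Space M] [SecondCountableTopology M] [IsManifold (𝓡 n) ∞ M] [CompactSpace M]
    (hn : 1 ≤ n) (hg : S.cobordism.IsMorseFunction g) (p : S.K) : D.ψ p ≤ D.μ ↔ g p ≤ m := by
  rw [← D.φ_le_iff hn hg p, ψ_def, μ_def]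
  have hs := D.sub_pos
  constructor
  · intro h
    have h' : D.θ (D.φ p) ≤ D.A * m := by nlinarith
    exact (D.le_θ (D.φ_le_A hn hg p)).1.trans h'
  · intro h
    rw [D.θ_of_le (h.trans D.Am_lt_Am₁.le)]
    nlinarith

/-- **`ψ = μ ↔ g = m`.** [folklore] -/
theorem ψ_eq_μ_iff [T2Space M] [SecondCountableTopology M] [IsManifold (𝓡 n) ∞ M] [CompactSpace M]
    (hn : 1 ≤ n) (hg : S.cobordism.IsMorseFunction g) (p : S.K) : D.ψ p = D.μ ↔ g p = m := by
  constructor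
  · intro h
    have hle : g p ≤ m := (D.ψ_le_μ_iff hn hg p).1 h.le
    rcases hle.lt_or_eq with hlt | heq
    · exfalso
      have hφ := D.φ_lt_of_lt hn hg hlt
      have hs := D.sub_pos
      have h1 := D.ψ_eq_of_φ_le (hφ.le.trans D.Am_lt_Am₁.le)
      have : D.ψ p < D.μ := by rw [h1, μ_def]; nlinarith
      exact this.ne h
    · exact heq
  · intro h
    have hφ : D.φ p = D.A * m := (D.φ_eq_iff hn hg p).2 h
    rw [D.ψ_eq_of_φ_le (by rw [hφ]; exact D.Am_lt_Am₁.le), hφ, μ_def]; ring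

/-! #### The global function `Ψ` -/

/-- On the slab, `Ψ ∘ incl = ψ`. [folklore] -/
@[simp] theorem Ψ_incl (p : S.K) : D.Ψ (RegularSlab.incl S.isRegularSlab p) = D.ψ p := by
  have hp : S.f (RegularSlab.incl S.isRegularSlab p) ∈ Icc S.botLevel S.b₀ := p.2
  rw [Ψ, dif_pos hp]
  rfl

/-- `Ψ ∘ incl = ψ`. [folklore] -/
theorem Ψ_comp_incl : D.Ψ ∘ RegularSlab.incl S.isRegularSlab = D.ψ := funext D.Ψ_incl

/-- On a point of the slab given ambiently. [folklore] -/
theorem Ψ_of_mem {z : c.W} (hz : S.f z ∈ Icc S.botLevel S.b₀) :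
    D.Ψ z = D.ψ (RegularSlab.mk S.isRegularSlab z hz) := by
  rw [Ψ, dif_pos hz]

/-- Below the ball level, `Ψ = f`. [folklore] -/
theorem Ψ_of_lt {z : c.W} (hz : S.f z < S.botLevel) : D.Ψ z = S.f z := by
  have hz' : S.f z ∉ Icc S.botLevel S.b₀ := fun h => (not_le.2 hz) h.1
  rw [Ψ, dif_neg hz', if_pos hz]

/-- Above the top level, `Ψ` is the constant `a₀ + (b₀ − a₀) A`. [folklore] -/
theorem Ψ_of_gt {z : c.W} (hz : S.b₀ < S.f z) : D.Ψ z = S.botLevel + (S.b₀ - S.botLevel) * D.A := by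
  have hz' : S.f z ∉ Icc S.botLevel S.b₀ := fun h => (not_le.2 hz) h.2
  have hz'' : ¬ S.f z < S.botLevel := not_lt.2 (S.botLevel_lt_b₀.le.trans hz.le)
  rw [Ψ, dif_neg hz', if_neg hz'']

/-- `μ` lies strictly between the ball level and the top constant. [folklore] -/
theorem botLevel_lt_μ : S.botLevel < D.μ := by
  have h := mul_pos D.sub_pos (show 0 < D.A * m by linarith [D.three_lt_Am])
  rw [μ_def]; linarith

/-- `μ` is below the top constant `a₀ + (b₀ − a₀) A`. [folklore] -/
theorem μ_lt_const : D.μ < S.botLevel + (S.b₀ - S.botLevel) * D.A := by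
  have h1 : D.A * m < D.A := by nlinarith [D.m_lt_one, D.A_pos]
  have h2 := mul_lt_mul_of_pos_left h1 D.sub_pos
  rw [μ_def]; linarith

/-- **The sublevel set `{Ψ ≤ μ}` on the slab is `{g ≤ m}`.** [folklore] -/
theorem Ψ_le_μ_iff_of_mem [T2Space M] [SecondCountableTopology M] [IsManifold (𝓡 n) ∞ M]
    [CompactSpace M] (hn : 1 ≤ n) (hg : S.cobordism.IsMorseFunction g) {z : c.W}
    (hz : S.f z ∈ Icc S.botLevel S.b₀) :
    D.Ψ z ≤ D.μ ↔ g (RegularSlab.mk S.isRegularSlab z hz) ≤ m := by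
  rw [D.Ψ_of_mem hz, D.ψ_le_μ_iff hn hg]

/-- **`Ψ = μ` exactly on the level `g = m` of the slab.** [folklore] -/
theorem Ψ_eq_μ_iff [T2Space M] [SecondCountableTopology M] [IsManifold (𝓡 n) ∞ M] [CompactSpace M]
    (hn : 1 ≤ n) (hg : S.cobordism.IsMorseFunction g) (z : c.W) :
    D.Ψ z = D.μ ↔ ∃ hz : S.f z ∈ Icc S.botLevel S.b₀, g (RegularSlab.mk S.isRegularSlab z hz) = m := by
  by_cases hz : S.f z ∈ Icc S.botLevel S.b₀
  · rw [D.Ψ_of_mem hz, D.ψ_eq_μ_iff hn hg]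
    exact ⟨fun h => ⟨hz, h⟩, fun ⟨_, h⟩ => h⟩
  · constructor
    · intro h
      exfalso
      rcases lt_or_ge (S.f z) S.botLevel with hlt | hge
      · rw [D.Ψ_of_lt hlt] at h; linarith [D.botLevel_lt_μ]
      · have hgt : S.b₀ < S.f z := not_le.1 fun hle => hz ⟨hge, hle⟩
        rw [D.Ψ_of_gt hgt] at h; linarith [D.μ_lt_const]
    · rintro ⟨hz', _⟩; exact absurd hz' hz

/-- A point with `Ψ ≤ μ` has `f ≤ b₀ < 1`, so it is an interior point of `W`. [folklore] -/
theorem isInteriorPoint_of_Ψ_le [T2Space M] [SecondCountableTopology M] [IsManifold (𝓡 n) ∞ M]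
    [CompactSpace M] {z : c.W} (hz : D.Ψ z ≤ D.μ) : (𝓡∂ (n + 1)).IsInteriorPoint z := by
  have hf1 : S.f z < 1 := by
    by_contra h1
    have hgt : S.b₀ < S.f z := S.b₀_lt_one.trans_le (not_lt.1 h1)
    rw [D.Ψ_of_gt hgt] at hz
    linarith [D.μ_lt_const]
  have hf0 : 0 < S.f z := by
    have hmem := S.isMorseFunction.mem_Icc z
    refine lt_of_le_of_ne hmem.1 fun h0 => ?_
    have hz0 : z ∈ S.f ⁻¹' {0} := h0.symm
    obtain ⟨x, -⟩ := (Set.ext_iff.1 S.isMorseFunction.preimage_zero z).1 hz0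
    exact x.elim
  exact S.isRegularSlab.isInteriorPoint_of_mem_Ioo ⟨hf0, hf1⟩

/-! #### Compactness: `Ψ = f` near the ball, `Ψ` constant near the top -/

/-- **A level `a⋆ > a₀` below which the slab points have `g < δ/3`** (the set `{δ/3 ≤ g}` is
compact and disjoint from the incoming end `{g = 0} = f⁻¹(a₀) ∩ K`). [folklore] -/
theorem exists_aStar [T2Space M] [SecondCountableTopology M] [IsManifold (𝓡 n) ∞ M] [CompactSpace M]
    (hn : 1 ≤ n) (hg : S.cobordism.IsMorseFunction g) :
    ∃ a₁ : ℝ, S.botLevel < a₁ ∧ a₁ ≤ S.b₀ ∧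
      ∀ p : S.K, S.f (RegularSlab.incl S.isRegularSlab p) < a₁ → g p < D.δ / 3 := by
  set Z : Set S.K := {p | D.δ / 3 ≤ g p} with hZ
  have hZc : IsCompact Z := (isClosed_le continuous_const hg.isMorse.contMDiff.continuous).isCompact
  have hcont : Continuous fun p : S.K => S.f (RegularSlab.incl S.isRegularSlab p) :=
    S.isMorseFunction.isMorse.contMDiff.continuous.comp (RegularSlab.continuous_incl S.isRegularSlab)
  by_cases hne : Z.Nonempty
  · obtain ⟨q, hq, hqmin⟩ := hZc.exists_isMinOn hne hcont.continuousOn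
    have hgq : 0 < g q := lt_of_lt_of_le (by linarith [D.δ_pos]) hq
    have hfq : S.botLevel < S.f (RegularSlab.incl S.isRegularSlab q) := by
      refine lt_of_le_of_ne q.2.1 fun h => hgq.ne' ?_
      have h0 : RegularSlab.fn S.isRegularSlab q = 0 := (RegularSlab.fn_eq_zero_iff S.isRegularSlab q).2 h.symm
      have h1 : q ∈ (RegularSlab.fn S.isRegularSlab) ⁻¹' {0} := h0
      have h2 := (Set.ext_iff.1 (S.isMorseFunction_fn hn).preimage_zero q).1 h1
      exact (Set.ext_iff.1 hg.preimage_zero q).2 h2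
    refine ⟨S.f (RegularSlab.incl S.isRegularSlab q), hfq, q.2.2, fun p hp => ?_⟩
    by_contra hle
    exact absurd (hqmin (not_lt.1 hle)) (not_le.2 hp)
  · refine ⟨S.b₀, S.botLevel_lt_b₀, le_rfl, fun p _ => ?_⟩
    by_contra hle
    exact hne ⟨p, not_lt.1 hle⟩

/-- **A level `b⋆ < b₀` above which the slab points have `g > m₂`** (the set `{g ≤ m₂}` is
compact and disjoint from the outgoing end `{g = 1} = f⁻¹(b₀) ∩ K`). [folklore] -/
theorem exists_bStar [T2Space M] [SecondCountableTopology M] [IsManifold (𝓡 n) ∞ M] [CompactSpace M]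
    (hn : 1 ≤ n) (hg : S.cobordism.IsMorseFunction g) :
    ∃ b₁ : ℝ, S.botLevel ≤ b₁ ∧ b₁ < S.b₀ ∧
      ∀ p : S.K, b₁ < S.f (RegularSlab.incl S.isRegularSlab p) → D.m₂ < g p := by
  set Z : Set S.K := {p | g p ≤ D.m₂} with hZ
  have hZc : IsCompact Z := (isClosed_le hg.isMorse.contMDiff.continuous continuous_const).isCompact
  have hcont : Continuous fun p : S.K => S.f (RegularSlab.incl S.isRegularSlab p) :=
    S.isMorseFunction.isMorse.contMDiff.continuous.comp (RegularSlab.continuous_incl S.isRegularSlab)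
  by_cases hne : Z.Nonempty
  · obtain ⟨q, hq, hqmax⟩ := hZc.exists_isMaxOn hne hcont.continuousOn
    have hgq : g q < 1 := lt_of_le_of_lt hq D.m₂_lt_one
    have hfq : S.f (RegularSlab.incl S.isRegularSlab q) < S.b₀ := by
      refine lt_of_le_of_ne q.2.2 fun h => hgq.ne ?_
      have h1 : RegularSlab.fn S.isRegularSlab q = 1 := (RegularSlab.fn_eq_one_iff S.isRegularSlab q).2 h
      have h2 : q ∈ (RegularSlab.fn S.isRegularSlab) ⁻¹' {1} := h1
      have h3 := (Set.ext_iff.1 (S.isMorseFunction_fn hn).preimage_one q).1 h2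
      exact (Set.ext_iff.1 hg.preimage_one q).2 h3
    refine ⟨S.f (RegularSlab.incl S.isRegularSlab q), q.2.1, hfq, fun p hp => ?_⟩
    by_contra hle
    exact absurd (hqmax (not_lt.1 hle)) (not_le.2 hp)
  · refine ⟨S.botLevel, le_rfl, S.botLevel_lt_b₀, fun p _ => ?_⟩
    by_contra hle
    exact hne ⟨p, not_lt.1 hle⟩

/-- **`Ψ = f` below `a⋆`.** [folklore] -/
theorem Ψ_eq_f_of_lt_aStar [T2Space M] [SecondCountableTopology M] [IsManifold (𝓡 n) ∞ M]
    [CompactSpace M] (hn : 1 ≤ n) {a₁ : ℝ} (ha₁b : a₁ ≤ S.b₀)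
    (ha₁ : ∀ p : S.K, S.f (RegularSlab.incl S.isRegularSlab p) < a₁ → g p < D.δ / 3) {z : c.W}
    (hz : S.f z < a₁) : D.Ψ z = S.f z := by
  by_cases hmem : S.f z ∈ Icc S.botLevel S.b₀
  · rw [D.Ψ_of_mem hmem, D.ψ_eq_f_of_le hn (ha₁ (RegularSlab.mk S.isRegularSlab z hmem) hz).le]; rfl
  · rcases lt_or_ge (S.f z) S.botLevel with hlt | hge
    · exact D.Ψ_of_lt hlt
    · exfalso
      have hgt : S.b₀ < S.f z := not_le.1 fun hle => hmem ⟨hge, hle⟩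
      linarith

/-- **`Ψ` is the constant `a₀ + (b₀ − a₀) A` above `b⋆`.** [folklore] -/
theorem Ψ_eq_const_of_gt_bStar {b₁ : ℝ} (hb₁a : S.botLevel ≤ b₁)
    (hb₁ : ∀ p : S.K, b₁ < S.f (RegularSlab.incl S.isRegularSlab p) → D.m₂ < g p) {z : c.W}
    (hz : b₁ < S.f z) : D.Ψ z = S.botLevel + (S.b₀ - S.botLevel) * D.A := by
  by_cases hmem : S.f z ∈ Icc S.botLevel S.b₀
  · rw [D.Ψ_of_mem hmem, D.ψ_eq_const_of_ge (hb₁ (RegularSlab.mk S.isRegularSlab z hmem) hz).le]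
  · rcases lt_or_ge (S.f z) S.botLevel with hlt | hge
    · exfalso; linarith
    · exact D.Ψ_of_gt (not_le.1 fun hle => hmem ⟨hge, hle⟩)

/-- **`Ψ` is smooth on `W`**: `W` is covered by the three open sets `{f < a⋆}` (where `Ψ = f`),
`{a₀ < f < b₀}` (the open slab, where `Ψ` is read through the slab and `ψ` is smooth,
`RegularSlab.contMDiffAt_of_comp_incl`) and `{b⋆ < f}` (where `Ψ` is constant).
[cite: WallJLMS1964, proof of Lemma 2 (p. 144: "H … can be chosen to be a smooth submanifold of W")] -/
theorem contMDiff_Ψ [T2Space M] [SecondCountableTopology M] [IsManifold (𝓡 n) ∞ M] [CompactSpace M]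
    (hn : 1 ≤ n) (hg : S.cobordism.IsMorseFunction g) : ContMDiff (𝓡∂ (n + 1)) 𝓘(ℝ, ℝ) ∞ D.Ψ := by
  obtain ⟨a₁, ha₀, ha₁b, ha₁⟩ := D.exists_aStar hn hg
  obtain ⟨b₁, hb₁a, hb₁b, hb₁⟩ := D.exists_bStar hn hg
  have hfs : ContMDiff (𝓡∂ (n + 1)) 𝓘(ℝ, ℝ) ∞ S.f := S.isMorseFunction.isMorse.contMDiff
  have hfc : Continuous S.f := hfs.continuous
  intro z
  by_cases h1 : S.f z < a₁
  · -- `Ψ = f` on the open set `{f < a₁}`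
    have ho : IsOpen {w : c.W | S.f w < a₁} := isOpen_lt hfc continuous_const
    refine (hfs z).congr_of_eventuallyEq ?_
    filter_upwards [ho.mem_nhds h1] with w hw
    exact D.Ψ_eq_f_of_lt_aStar hn ha₁b ha₁ hw
  by_cases h3 : b₁ < S.f z
  · -- `Ψ` constant on the open set `{b₁ < f}`
    have ho : IsOpen {w : c.W | b₁ < S.f w} := isOpen_lt continuous_const hfc
    refine (contMDiffAt_const (c := S.botLevel + (S.b₀ - S.botLevel) * D.A)).congr_of_eventuallyEq ?_
    filter_upwards [ho.mem_nhds h3] with w hw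
    exact D.Ψ_eq_const_of_gt_bStar hb₁a hb₁ hw
  · -- the open slab
    have hza : S.botLevel < S.f z := ha₀.trans_le (not_lt.1 h1)
    have hzb : S.f z < S.b₀ := (not_lt.1 h3).trans_lt hb₁b
    have hmem : S.f z ∈ Icc S.botLevel S.b₀ := ⟨hza.le, hzb.le⟩
    have hcomp : ContMDiff (𝓡∂ (n + 1)) 𝓘(ℝ, ℝ) ∞ (D.Ψ ∘ RegularSlab.incl S.isRegularSlab) :=
      D.contMDiff_ψ.congr fun q => D.Ψ_incl q
    exact RegularSlab.contMDiffAt_of_comp_incl S.isRegularSlab (F := D.Ψ)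
      (RegularSlab.mk S.isRegularSlab z hmem) ⟨hza, hzb⟩ (hcomp _)

/-! #### Critical points of `Ψ` -/

/-- **Critical points on the slab**: `incl p` is critical for `Ψ` iff `p` is critical for `ψ`.
[cite: MilnorHCobordism1965, Lemma 2.9] -/
theorem isMCriticalPt_Ψ_incl_iff [T2Space M] [SecondCountableTopology M] [IsManifold (𝓡 n) ∞ M]
    [CompactSpace M] (hn : 1 ≤ n) (hg : S.cobordism.IsMorseFunction g) (p : S.K) :
    IsMCriticalPt (𝓡∂ (n + 1)) D.Ψ (RegularSlab.incl S.isRegularSlab p) ↔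
      IsMCriticalPt (𝓡∂ (n + 1)) D.ψ p := by
  have h1 := RegularSlab.isMCriticalPt_comp_incl_iff S.isRegularSlab hn (D.contMDiff_Ψ hn hg) p
  have h2 : IsMCriticalPt (𝓡∂ (n + 1)) (D.Ψ ∘ RegularSlab.incl S.isRegularSlab) p ↔
      IsMCriticalPt (𝓡∂ (n + 1)) D.ψ p :=
    isMCriticalPt_congr_of_eventuallyEq (Filter.Eventually.of_forall fun q => D.Ψ_incl q)
  exact h1.symm.trans h2

/-- Where `φ < A m₁`, `p` is critical for `ψ` iff it is critical for `φ`, iff it is critical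
for `g`. [cite: MilnorHCobordism1965, Thm. 4.8 (alternate version)] -/
theorem isMCriticalPt_ψ_iff {p : S.K} (hp : D.φ p < D.A * D.m₁) :
    IsMCriticalPt (𝓡∂ (n + 1)) D.ψ p ↔ p ∈ criticalSet (𝓡∂ (n + 1)) g := by
  rw [isMCriticalPt_congr_of_eventuallyEq (I := 𝓡∂ (n + 1)) (D.ψ_eventuallyEq hp),
    isMCriticalPt_const_mul_add_iff D.sub_pos.ne' S.botLevel
      (D.contMDiff_φ.mdifferentiableAt (by simp)), ← D.criticalSet_φ]
  rfl

/-- **The critical points of `Ψ` on `{Ψ ≤ μ} ∩ K` are the critical points of `g` below `m`.**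
[cite: MilnorHCobordism1965, Lemma 2.9 and Thm. 4.8] -/
theorem isMCriticalPt_Ψ_incl_iff_of_le [T2Space M] [SecondCountableTopology M] [IsManifold (𝓡 n) ∞ M]
    [CompactSpace M] (hn : 1 ≤ n) (hg : S.cobordism.IsMorseFunction g) {p : S.K} (hp : g p ≤ m) :
    IsMCriticalPt (𝓡∂ (n + 1)) D.Ψ (RegularSlab.incl S.isRegularSlab p) ↔
      p ∈ criticalSet (𝓡∂ (n + 1)) g := by
  have hφ : D.φ p < D.A * D.m₁ := ((D.φ_le_iff hn hg p).2 hp).trans_lt D.Am_lt_Am₁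
  rw [D.isMCriticalPt_Ψ_incl_iff hn hg, D.isMCriticalPt_ψ_iff hφ]

/-- **`μ` is a regular value of `Ψ`** when `m` is a regular value of `g`. [folklore] -/
theorem Ψ_ne_μ_of_isMCriticalPt [T2Space M] [SecondCountableTopology M] [IsManifold (𝓡 n) ∞ M]
    [CompactSpace M] (hn : 1 ≤ n) (hg : S.cobordism.IsMorseFunction g)
    (hregm : ∀ p ∈ criticalSet (𝓡∂ (n + 1)) g, g p ≠ m) {z : c.W}
    (hz : IsMCriticalPt (𝓡∂ (n + 1)) D.Ψ z) : D.Ψ z ≠ D.μ := by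
  intro h
  obtain ⟨hmem, hgm⟩ := (D.Ψ_eq_μ_iff hn hg z).1 h
  have hz' : IsMCriticalPt (𝓡∂ (n + 1)) D.Ψ (RegularSlab.incl S.isRegularSlab (RegularSlab.mk S.isRegularSlab z hmem)) := hz
  have hc := (D.isMCriticalPt_Ψ_incl_iff_of_le hn hg hgm.le).1 hz'
  exact hregm _ hc hgm

/-- **The Hessian and the index of `Ψ` at a critical point of the slab below `m`** are those of
`g` (up to the positive factor `(b₀ − a₀) · 3/δ`). [cite: MilnorHCobordism1965, Lemma 2.9 and Thm. 4.8 (alternate version)] -/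
theorem morseIndex_Ψ_incl_eq [T2Space M] [SecondCountableTopology M] [IsManifold (𝓡 n) ∞ M]
    [CompactSpace M] (hn : 1 ≤ n) (hg : S.cobordism.IsMorseFunction g) {p : S.K} (hp : g p ≤ m)
    (hc : p ∈ criticalSet (𝓡∂ (n + 1)) g) :
    morseIndex (𝓡∂ (n + 1)) D.Ψ (RegularSlab.incl S.isRegularSlab p) = morseIndex (𝓡∂ (n + 1)) g p := by
  have hφ : D.φ p < D.A * D.m₁ := ((D.φ_le_iff hn hg p).2 hp).trans_lt D.Am_lt_Am₁
  have hIoo : S.f (RegularSlab.incl S.isRegularSlab p) ∈ Ioo S.botLevel S.b₀ := by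
    refine ⟨lt_of_le_of_ne p.2.1 fun h => ?_, lt_of_le_of_ne p.2.2 fun h => ?_⟩
    · -- on the incoming end `g = 0 < δ < g p`? there `g = 0` is not critical... use `δ < g p`
      have h0 : RegularSlab.fn S.isRegularSlab p = 0 := (RegularSlab.fn_eq_zero_iff S.isRegularSlab p).2 h.symm
      have h1 : p ∈ (RegularSlab.fn S.isRegularSlab) ⁻¹' {0} := h0
      have h2 := (Set.ext_iff.1 (S.isMorseFunction_fn hn).preimage_zero p).1 h1
      have h3 : g p = 0 := (Set.ext_iff.1 hg.preimage_zero p).2 h2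
      linarith [D.δ_lt_of_mem p hc, D.δ_pos]
    · have h0 : RegularSlab.fn S.isRegularSlab p = 1 := (RegularSlab.fn_eq_one_iff S.isRegularSlab p).2 h
      have h1 : p ∈ (RegularSlab.fn S.isRegularSlab) ⁻¹' {1} := h0
      have h2 := (Set.ext_iff.1 (S.isMorseFunction_fn hn).preimage_one p).1 h1
      have h3 : g p = 1 := (Set.ext_iff.1 hg.preimage_one p).2 h2
      linarith [D.m_lt_one]
  have e1 := RegularSlab.morseIndex_comp_incl_eq S.isRegularSlab (F := D.Ψ) p hIoo
  have e2 : morseIndex (𝓡∂ (n + 1)) (D.Ψ ∘ RegularSlab.incl S.isRegularSlab) p =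
      morseIndex (𝓡∂ (n + 1)) D.ψ p :=
    morseIndex_congr_of_eventuallyEq (Filter.Eventually.of_forall fun q => D.Ψ_incl q)
  have e3 : morseIndex (𝓡∂ (n + 1)) D.ψ p =
      morseIndex (𝓡∂ (n + 1)) (fun q => (S.b₀ - S.botLevel) * D.φ q + S.botLevel) p :=
    morseIndex_congr_of_eventuallyEq (I := 𝓡∂ (n + 1)) (D.ψ_eventuallyEq hφ)
  have e4 := morseIndex_const_mul_add (I := 𝓡∂ (n + 1)) D.φ D.sub_pos S.botLevel p
  exact e1.symm.trans (e2.trans (e3.trans (e4.trans (D.morseIndex_φ p hc))))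

/-- The Hessian of `Ψ` at a critical point of the slab below `m` is nondegenerate. [cite: MilnorHCobordism1965, Lemma 2.9 and Thm. 4.8 (alternate version)] -/
theorem nondegenerate_Ψ_incl [T2Space M] [SecondCountableTopology M] [IsManifold (𝓡 n) ∞ M]
    [CompactSpace M] (hn : 1 ≤ n) (hg : S.cobordism.IsMorseFunction g) {p : S.K} (hp : g p ≤ m)
    (hc : p ∈ criticalSet (𝓡∂ (n + 1)) g) :
    (mhessian (𝓡∂ (n + 1)) D.Ψ (RegularSlab.incl S.isRegularSlab p)).Nondegenerate := by
  have hφ : D.φ p < D.A * D.m₁ := ((D.φ_le_iff hn hg p).2 hp).trans_lt D.Am_lt_Am₁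
  have hIoo : S.f (RegularSlab.incl S.isRegularSlab p) ∈ Ioo S.botLevel S.b₀ := by
    refine ⟨lt_of_le_of_ne p.2.1 fun h => ?_, lt_of_le_of_ne p.2.2 fun h => ?_⟩
    · have h0 : RegularSlab.fn S.isRegularSlab p = 0 := (RegularSlab.fn_eq_zero_iff S.isRegularSlab p).2 h.symm
      have h1 : p ∈ (RegularSlab.fn S.isRegularSlab) ⁻¹' {0} := h0
      have h2 := (Set.ext_iff.1 (S.isMorseFunction_fn hn).preimage_zero p).1 h1
      have h3 : g p = 0 := (Set.ext_iff.1 hg.preimage_zero p).2 h2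
      linarith [D.δ_lt_of_mem p hc, D.δ_pos]
    · have h0 : RegularSlab.fn S.isRegularSlab p = 1 := (RegularSlab.fn_eq_one_iff S.isRegularSlab p).2 h
      have h1 : p ∈ (RegularSlab.fn S.isRegularSlab) ⁻¹' {1} := h0
      have h2 := (Set.ext_iff.1 (S.isMorseFunction_fn hn).preimage_one p).1 h1
      have h3 : g p = 1 := (Set.ext_iff.1 hg.preimage_one p).2 h2
      linarith [D.m_lt_one]
  have e1 := RegularSlab.mhessian_comp_incl_eq S.isRegularSlab (F := D.Ψ) p hIoo
  have hev0 : (D.Ψ ∘ RegularSlab.incl S.isRegularSlab) =ᶠ[𝓝 p] D.ψ :=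
    Filter.Eventually.of_forall fun q => D.Ψ_incl q
  have hev2 : (fun q => (S.b₀ - S.botLevel) * D.φ q + S.botLevel) =ᶠ[𝓝 p]
      fun q => ((S.b₀ - S.botLevel) * D.φ q + S.botLevel) + 0 :=
    Filter.Eventually.of_forall fun q =>
      (by ring : (S.b₀ - S.botLevel) * D.φ q + S.botLevel = ((S.b₀ - S.botLevel) * D.φ q + S.botLevel) + 0)
  have hev : (D.Ψ ∘ RegularSlab.incl S.isRegularSlab) =ᶠ[𝓝 p]
      fun q => ((S.b₀ - S.botLevel) * D.φ q + S.botLevel) + 0 :=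
    hev0.trans ((D.ψ_eventuallyEq hφ).trans hev2)
  have e2 := mhessian_congr_of_eventuallyEq_add_const (I := 𝓡∂ (n + 1)) (c := 0) hev
  have hAg := D.isMorse_φ.const_mul_add D.sub_pos.ne' S.botLevel
  have hc' : IsMCriticalPt (𝓡∂ (n + 1)) D.φ p := by
    have : p ∈ criticalSet (𝓡∂ (n + 1)) D.φ := by rw [D.criticalSet_φ]; exact hc
    exact this
  have hnd := hAg.nondegenerate ((isMCriticalPt_const_mul_add_iff D.sub_pos.ne' S.botLevel
    (D.contMDiff_φ.mdifferentiableAt (by simp))).2 hc')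
  exact (congrArg LinearMap.BilinForm.Nondegenerate (e1.symm.trans e2)).mpr hnd

end Splice

end BottomSlab

end NullCobordism

end Literature.Topology.FourManifolds
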